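import Literature.NumberTheory.EllipticCurves.ComplexMultiplicationLocalFactorsAux

/-!
# Counting the `𝔽_q`-points of a Weierstrass equation column by column (Euler's criterion)

Topic `NumberTheory/EllipticCurves`; theorems only (no definition, no named fact). For a Weierstrass
equation `y² + a₁xy + a₃y = x³ + a₂x² + a₄x + a₆` over a finite field `F` of odd characteristic the
number of affine solutions is `Σ_x ε(d(x))` with the discriminant of the column quadratic
`d(x) = (a₁x + a₃)² + 4(x³ + a₂x² + a₄x + a₆)` and `ε(0) = 1`, `ε(d) = 2` if `d^{(q-1)/2} = 1`,
`ε(d) = 0` otherwise (completing the square, `#{z : z² = d} = χ(d) + 1` for the quadratic character —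
Mathlib's `quadraticChar_card_sqrts` — and Euler's criterion `quadraticChar_eq_pow_of_char_ne_two`).

Purpose: together with the tree's `WeierstrassCurve.natCard_point_eq_one_add_card`
(`#W(F) = 1 + #{solutions}`) this turns a point count `#Ẽ(𝔽_ℓ) = n` — hence a trace of Frobenius
`a_ℓ = ℓ + 1 - n` of `Literature.NumberTheory.Automorphic.numPointsMod` /
`WeierstrassCurve.reductionPointCount` — into a closed statement the kernel decides in `O(ℓ log ℓ)`
ring operations instead of `O(ℓ²)` (`decide +kernel`; e.g. `ℓ = 397` in a few seconds). Consumers: the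
Frobenius (isogeny-character) certificates `RationalIsogenyFrobeniusCertificates*.lean` for the
composite levels of Kenku's theorem (no rational cyclic `N`-isogeny), via Mazur 1978, Prop. 6.3 (1)
(`Mazur1978.isogenyCharacter_sq_sub_frobeniusTrace_mul_add_eq_zero`).

* `card_filter_sq_add_mul_eq` — `#{y : y² + by = c} = χ(b² + 4c) + 1`;
* `card_filter_sq_add_mul_eq_ite` — the same as `1 / 2 / 0` by Euler's criterion;
* `card_sol_eq_sum_euler` — the column-by-column count of a Weierstrass equation.

## References

* K. Ireland, M. Rosen, *A Classical Introduction to Modern Number Theory*, 2nd ed., GTM 84 (1990),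
  Prop. 5.1.2 (Euler's criterion), §8.1–8.2 and Ch. 10 §1–2 (counting `y² = f(x)` by the quadratic
  character). [IrelandRosen1990]
* B. Mazur, *Rational isogenies of prime degree*, Invent. Math. 44 (1978), Prop. 6.3 (1). [Mazur1978]
-/

namespace Literature.NumberTheory.EllipticCurves

open Finset

/-- **Completing the square over a finite field of odd characteristic**:
`#{y : y² + by = c} = #{z : z² = b² + 4c}` (`z = 2y + b`) `= χ(b² + 4c) + 1` for the quadratic
character `χ` (Mathlib `quadraticChar_card_sqrts`). [folklore] -/
theorem card_filter_sq_add_mul_eq {F : Type*} [Field F] [Fintype F] [DecidableEq F]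
    (hF : ringChar F ≠ 2) (b c : F) :
    (((univ.filter fun y : F => y ^ 2 + b * y = c).card : ℕ) : ℤ)
      = quadraticChar F (b ^ 2 + 4 * c) + 1 := by
  have h2 : (2 : F) ≠ 0 := Ring.two_ne_zero hF
  rw [← quadraticChar_card_sqrts hF (b ^ 2 + 4 * c)]
  norm_cast
  refine Finset.card_bij (fun y _ => 2 * y + b) ?_ ?_ ?_
  · intro y hy
    simp only [mem_filter, mem_univ, true_and] at hy
    simp only [Set.mem_toFinset, Set.mem_setOf_eq]
    linear_combination 4 * hy
  · intro y₁ _ y₂ _ h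
    have h' : (2 : F) * y₁ = 2 * y₂ := add_right_cancel h
    exact mul_left_cancel₀ h2 h'
  · intro z hz
    simp only [Set.mem_toFinset, Set.mem_setOf_eq] at hz
    refine ⟨(z - b) / 2, ?_, ?_⟩
    · simp only [mem_filter, mem_univ, true_and]
      field_simp
      linear_combination hz
    · field_simp
      ring

/-- **Euler's criterion form of the column count**: `#{y : y² + by = c}` is `1`, `2` or `0` according as
`d = b² + 4c` is `0`, a non-zero square (`d^{(q-1)/2} = 1`, Ireland–Rosen Prop. 5.1.2 / Mathlib
`quadraticChar_eq_pow_of_char_ne_two`), or a non-square. [folklore] -/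
theorem card_filter_sq_add_mul_eq_ite {F : Type*} [Field F] [Fintype F] [DecidableEq F]
    (hF : ringChar F ≠ 2) (b c : F) :
    (univ.filter fun y : F => y ^ 2 + b * y = c).card
      = if b ^ 2 + 4 * c = 0 then 1 else if (b ^ 2 + 4 * c) ^ (Fintype.card F / 2) = 1 then 2 else 0 := by
  have h := card_filter_sq_add_mul_eq hF b c
  by_cases hd : b ^ 2 + 4 * c = 0
  · rw [hd, quadraticChar_zero] at h
    rw [if_pos hd]
    exact_mod_cast h
  · rw [quadraticChar_eq_pow_of_char_ne_two hF hd] at h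
    rw [if_neg hd]
    split_ifs at h with h1
    · rw [if_pos h1]; exact_mod_cast h
    · rw [if_neg h1]; omega

/-- **Column-by-column point count of a Weierstrass equation over a finite field of odd
characteristic**: `#{(x, y) : y² + a₁xy + a₃y = x³ + a₂x² + a₄x + a₆} = Σ_x ε(d(x))` with
`d(x) = (a₁x + a₃)² + 4(x³ + a₂x² + a₄x + a₆)`, `ε(0) = 1`, `ε(d) = 2` if `d^{(q-1)/2} = 1`, else `0`
(the left side is exactly the right side of the tree's `WeierstrassCurve.natCard_point_eq_one_add_card`).
[folklore] -/
theorem card_sol_eq_sum_euler {F : Type*} [Field F] [Fintype F] [DecidableEq F] (hF : ringChar F ≠ 2)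
    (W : WeierstrassCurve F) :
    Fintype.card {xy : F × F //
        xy.2 ^ 2 + W.a₁ * xy.1 * xy.2 + W.a₃ * xy.2 = xy.1 ^ 3 + W.a₂ * xy.1 ^ 2 + W.a₄ * xy.1 + W.a₆}
      = ∑ x : F, (if (W.a₁ * x + W.a₃) ^ 2 + 4 * (x ^ 3 + W.a₂ * x ^ 2 + W.a₄ * x + W.a₆) = 0 then 1
          else if ((W.a₁ * x + W.a₃) ^ 2 + 4 * (x ^ 3 + W.a₂ * x ^ 2 + W.a₄ * x + W.a₆))
            ^ (Fintype.card F / 2) = 1 then 2 else 0) := by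
  rw [Fintype.card_congr (Equiv.subtypeProdEquivSigmaSubtype
      (fun x y : F => y ^ 2 + W.a₁ * x * y + W.a₃ * y = x ^ 3 + W.a₂ * x ^ 2 + W.a₄ * x + W.a₆)),
    Fintype.card_sigma]
  refine Finset.sum_congr rfl fun x _ => ?_
  rw [Fintype.card_subtype, ← card_filter_sq_add_mul_eq_ite hF (W.a₁ * x + W.a₃)
    (x ^ 3 + W.a₂ * x ^ 2 + W.a₄ * x + W.a₆)]
  congr 1
  ext y
  simp only [mem_filter, mem_univ, true_and]
  constructor <;> intro h <;> linear_combination h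

/-- Usage example (and regression test of the kernel evaluation path): the curve
`y² + xy = x³ + x² - 2x - 7` (`j = -11²`, a point of `X₀(11)(ℚ)`) has `99` points over `𝔽₈₉`, i.e.
`a₈₉ = -9`, decided by the kernel through `card_sol_eq_sum_euler`. [folklore] -/
theorem numPoints_example_j_neg121_mod_89 :
    Nat.card (((⟨1, 1, 0, -2, -7⟩ : WeierstrassCurve ℤ).map (Int.castRingHom (ZMod 89))).toAffine.Point)
      = 99 := by
  rw [@WeierstrassCurve.natCard_point_eq_one_add_card (ZMod 89) (@ZMod.instField 89 ⟨by norm_num⟩) _ _ _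
    (by decide +kernel), @card_sol_eq_sum_euler (ZMod 89) (@ZMod.instField 89 ⟨by norm_num⟩) _ _
    (by rw [ZMod.ringChar_zmod_n]; decide), ZMod.card]
  decide +kernel

end Literature.NumberTheory.EllipticCurves
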